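import Literature.AnabelianGeometry.SemiGraphs.ProSigmaFreeFactorMalnormal
import HarnessLib

/-!
# Free factors in pro-`Σ` completions, VI: the closure of a free factor is its pro-`Σ` completion

Setting as in `ProSigmaFreeFactorMalnormal.lean` (Ribes–Zalesskii, *Profinite Groups*, §9.1
[cite: RibesZalesskii2010, Thm. 9.1.12]): `Γ` free with basis `b : β → Γ`, `ι : Γ → P` a pro-`Σ`
completion (`P` profinite), `Γ_S = ⟨b(S)⟩` the free factor on `S ⊆ β` and
`A_S = closure ι(Γ_S) = ((Subgroup.closure (b '' S)).map ι).topologicalClosure`.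

* `freeFactor_isProSigmaCompletion` — the restriction `ι| : Γ_S → A_S` exhibits `A_S` as THE pro-`Σ`
  completion of the free group `Γ_S` (abc-iut-L3-t1's interface `IsProSigmaCompletion`): dense image
  (by definition of `A_S`), open subgroups of `A_S` of `Σ`-integer index (`A_S` is a closed subgroup
  of the pro-`Σ` group `P`), and — the point — UNIVERSALITY: a normal `Σ`-index `M ⊴ Γ_S` is pulled
  back along the RETRACTION `ρ : Γ → Γ_S` to a normal `Σ`-index subgroup of `Γ`, realised by an open
  `U ≤ P`, and `U ∩ A_S` realises `M` because `ρ|_{Γ_S} = id`;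
* `freeFactor_exists_continuousMulEquiv` — hence `A_S` is isomorphic, compatibly with `ι`, to any
  other pro-`Σ` completion of `Γ_S` (`exists_continuousMulEquiv`).

Use: the verticial subgroups of the genuine two-vertex PSC datum (`PSCTwoTripodOrigin.lean`) are
pro-`Σ` FREE groups of rank 2 — the "maximal pro-`Σ` quotient of the fundamental group of a tripod"
required of `Π_v` by [SemiAnbd] Ex. 2.10 / [CombGC] Def. 1.1 — so every rank-based theorem of the tree
(cusp inertia, slimness, …) applies INSIDE a vertex group.  Theorems only; classical profinite group
theory; nothing here takes a side on [IUTchIII] Cor. 3.12.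
-/

namespace Literature.AnabelianGeometry.SemiGraphs.SemiGraphOfAnabelioids.IsProSigmaCompletion

open Literature.AnabelianGeometry.Anabelioids Topology
open scoped Pointwise

variable {Sigma : Set ℕ} {Γ : Type*} [Group Γ] {P : Type*} [Group P] [TopologicalSpace P]
  [IsTopologicalGroup P] [CompactSpace P] [TotallyDisconnectedSpace P] {ι : Γ →* P}

omit [CompactSpace P] [TotallyDisconnectedSpace P] in
/-- `ι` maps `Γ_S` into `A_S`. [cite: RibesZalesskii2010, Thm. 9.1.12] -/
theorem map_mem_freeFactor {β : Type*} (b : FreeGroupBasis β Γ) (S : Set β)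
    (d : Subgroup.closure (b '' S)) :
    (ι.comp (Subgroup.closure (b '' S)).subtype) d ∈
      ((Subgroup.closure (b '' S)).map ι).topologicalClosure :=
  Subgroup.le_topologicalClosure _ ⟨d, d.2, rfl⟩

/-- **The closure of a free factor is its pro-`Σ` completion.**  For `Γ` free with basis `b`,
`S ⊆ β`, `ι : Γ → P` a pro-`Σ` completion (`P` profinite): the restriction
`ι| : Γ_S = ⟨b(S)⟩ → A_S = closure ι(Γ_S)` satisfies `IsProSigmaCompletion Σ`.  (Universality through
the retraction `ρ : Γ → Γ_S`: a normal `Σ`-index `M ⊴ Γ_S` gives the normal `Σ`-index `ρ⁻¹M ⊴ Γ`, an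
open `U ≤ P` with `ι⁻¹U = ρ⁻¹M`, and then `(ι|)⁻¹(U ∩ A_S) = Γ_S ∩ ρ⁻¹M = M`.)
[cite: RibesZalesskii2010, Thm. 9.1.12] -/
theorem freeFactor_isProSigmaCompletion [T2Space P] {β : Type*} (b : FreeGroupBasis β Γ) (S : Set β)
    (hι : IsProSigmaCompletion Sigma ι) :
    IsProSigmaCompletion Sigma ((ι.comp (Subgroup.closure (b '' S)).subtype).codRestrict
      ((Subgroup.closure (b '' S)).map ι).topologicalClosure (map_mem_freeFactor b S)) := by
  classical
  -- the retraction into the subtype `Γ_S`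
  let ρ₀ : Γ →* Subgroup.closure (b '' S) :=
    b.lift fun j => if h : j ∈ S then ⟨b j, Subgroup.subset_closure ⟨j, h, rfl⟩⟩ else 1
  let ρ : Γ →* Γ := b.lift fun j => if j ∈ S then b j else 1
  have hρ : ∀ j, ρ (b j) = if j ∈ S then b j else 1 := fun j => b.lift_apply_basis _ j
  have hρ₀ρ : (Subgroup.closure (b '' S)).subtype.comp ρ₀ = ρ := by
    refine b.ext_hom _ _ fun j => ?_
    rw [MonoidHom.comp_apply, hρ j]
    change ((b.lift _ (b j) : Subgroup.closure (b '' S)) : Γ) = _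
    rw [FreeGroupBasis.lift_apply_basis]
    by_cases h : j ∈ S
    · rw [dif_pos h, if_pos h]
    · rw [dif_neg h, if_neg h]; rfl
  obtain ⟨-, hρid, -⟩ := retract_mem_closure b S ρ hρ
  have hρ₀id : ∀ d : Subgroup.closure (b '' S), ρ₀ d = d := fun d => by
    apply Subtype.ext
    change ((Subgroup.closure (b '' S)).subtype.comp ρ₀) d = d
    rw [hρ₀ρ]
    exact hρid d d.2
  have hρ₀surj : Function.Surjective ρ₀ := fun d => ⟨d, hρ₀id d⟩
  refine ⟨?_, ?_, ?_⟩
  · -- dense image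
    intro x
    rw [IsInducing.subtypeVal.closure_eq_preimage_closure_image, Set.mem_preimage]
    have hx : (x : P) ∈ closure (ι '' (Subgroup.closure (b '' S) : Set Γ)) := by
      have h0 : (x : P) ∈ (((Subgroup.closure (b '' S)).map ι).topologicalClosure : Set P) := x.2
      rwa [Subgroup.topologicalClosure_coe, Subgroup.coe_map] at h0
    refine closure_mono ?_ hx
    rintro _ ⟨d, hd, rfl⟩
    exact ⟨⟨ι d, Subgroup.le_topologicalClosure _ ⟨d, hd, rfl⟩⟩, ⟨⟨d, hd⟩, rfl⟩, rfl⟩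
  · -- open normal subgroups of `A_S` have `Σ`-integer index
    intro N _ hNo
    obtain ⟨V, hV, hVN⟩ := isOpen_induced_iff.mp hNo
    have h1V : (1 : P) ∈ V := by
      have h1 : (1 : ((Subgroup.closure (b '' S)).map ι).topologicalClosure) ∈
          ((↑) : ((Subgroup.closure (b '' S)).map ι).topologicalClosure → P) ⁻¹' V := by
        rw [hVN]; exact N.one_mem
      exact h1
    obtain ⟨M, hM⟩ := ProfiniteGrp.exist_openNormalSubgroup_sub_open_nhds_of_one hV h1V
    haveI : (M : Subgroup P).Normal := M.isNormal'
    have hle : (M : Subgroup P).subgroupOf ((Subgroup.closure (b '' S)).map ι).topologicalClosure ≤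
        N := by
      intro z hz
      have : ((z : P)) ∈ V := hM hz
      have hz' : z ∈ ((↑) : _ → P) ⁻¹' V := this
      rw [hVN] at hz'
      exact hz'
    have hidx := hι.index_open (M : Subgroup P) M.isNormal' M.isOpen'
    refine (hidx.of_dvd (Subgroup.relIndex_dvd_index_of_normal (M : Subgroup P)
      ((Subgroup.closure (b '' S)).map ι).topologicalClosure)).of_dvd ?_
    exact Subgroup.index_dvd_of_le hle
  · -- universality
    intro M hMn hM
    haveI := hMn
    have hidx : (M.comap ρ₀).index = M.index := Subgroup.index_comap_of_surjective M hρ₀surj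
    obtain ⟨U, hUo, hU⟩ := hι.comap_surj (M.comap ρ₀) inferInstance (hidx ▸ hM)
    refine ⟨U.subgroupOf ((Subgroup.closure (b '' S)).map ι).topologicalClosure,
      Subgroup.subgroupOf_isOpen _ U hUo, ?_⟩
    ext d
    rw [Subgroup.mem_comap, Subgroup.mem_subgroupOf]
    change ι ((d : Γ)) ∈ U ↔ d ∈ M
    rw [← Subgroup.mem_comap, hU, Subgroup.mem_comap, hρ₀id]

/-- **`A_S` is isomorphic to any pro-`Σ` completion of the free factor `Γ_S`**, compatibly with the
structure maps (uniqueness of pro-`Σ` completions).  E.g. a verticial subgroup of the two-tripod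
datum is a pro-`Σ` free group of rank `2`. [cite: RibesZalesskii2010, Thm. 9.1.12] -/
theorem freeFactor_exists_continuousMulEquiv [T2Space P] {β : Type*} (b : FreeGroupBasis β Γ)
    (S : Set β) (hι : IsProSigmaCompletion Sigma ι) {P' : Type*} [Group P'] [TopologicalSpace P']
    [IsTopologicalGroup P'] [CompactSpace P'] [T2Space P'] [TotallyDisconnectedSpace P']
    {κ : Subgroup.closure (b '' S) →* P'} (hκ : IsProSigmaCompletion Sigma κ) :
    ∃ e : ((Subgroup.closure (b '' S)).map ι).topologicalClosure ≃ₜ* P',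
      ∀ d : Subgroup.closure (b '' S), e ⟨ι d, map_mem_freeFactor b S d⟩ = κ d := by
  haveI : CompactSpace ((Subgroup.closure (b '' S)).map ι).topologicalClosure :=
    isCompact_iff_compactSpace.mp (Subgroup.isClosed_topologicalClosure _).isCompact
  obtain ⟨e, he⟩ := exists_continuousMulEquiv (freeFactor_isProSigmaCompletion b S hι) hκ
  exact ⟨e, fun d => he d⟩

end Literature.AnabelianGeometry.SemiGraphs.SemiGraphOfAnabelioids.IsProSigmaCompletion
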